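import Summits.BirchSwinnertonDyer.BirchSwinnertonDyer.Theorems.Rank1ResidualJetRowDualityEll
import Summits.BirchSwinnertonDyer.BirchSwinnertonDyer.Theorems.Rank1ResidualJetRowDualityCarrier
import Summits.BirchSwinnertonDyer.BirchSwinnertonDyer.Theorems.Rank1ResidualJetGlobalDualityLocal
import HarnessLib

/-!
# The supply's conjunct `hPT`: Jetchev's Lemma 5.2 (iii) — the image at a Kolyvagin prime `λ ∤ c` of
# the `±`-part of the RELAXED Selmer group `H¹_{𝓕(c)^λ}(K, E[p^k])^±` in `H¹(K_λ, E[p^k])` has order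
# `p^k` (cell `bsd-stepL`, seat `bsd-stepL-tam3-p1`, helper toward item 19109 `EulerHalvesAtThree`,
# registered stub `stub_supplyAtThree`)

HONEST FRAMING. Nothing here proves BSD, J₃ or any divisibility of a Heegner point; no stub is
discharged; no item closes; 0 classes move (T7); `--supports stmt-BirchSwinnertonDyer-19109` (helper).

WHAT THIS FILE DOES. The kernel walk's Prop. 6.4 (potential argument, this seat's `…CoreVertexAdm`)
consumes, at every step, the count `#loc_λ((H_{𝓕(s)^λ})^±) = p^k` (`hPT`). bsd-jet pv-1's signed
counting `relIndex_mul_natCard_map_eq_of_relaxedAt` (p?, `…SignedDualityRelaxed`) gives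
`[H_{𝓕^λ}^s : H_𝓕^s] · #loc'_λ((H_{𝓕^*})^s) = [H¹(K_λ)^s : Kum_λ^s]` for the pair `𝓕 ≤ 𝓕^λ`; the right
side is `p^k` by Lemma 5.2 (i)–(ii) (`hloc`, local print-to-type). This file adds the PRIMAL
identification: `𝓕(c) = selmerF W p^k 𝒯 (placesDividing K c)` is SELF-DUAL under the Weil transport
(`dualTransported_selmerF_eq`: Tate local duality for `E` at the Kummer places is a tree theorem,
`h𝒯sd` at the transverse places), so `#loc'_λ((H_{𝓕^*})^s) = #loc_λ(H_𝓕^s)`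
(`comap_map_weilDual_selmerGroup_of_selfDual`, `signPart_comap_map_weilDual`,
`natCard_map_localization_map_weilDual`), and the index bookkeeping
`#loc_λ(H_{𝓕^λ}^s) = [H_{𝓕^λ}^s : H_𝓕^s] · #loc_λ(H_𝓕^s)` (`natCard_map_eq_relIndex_mul`: the classes of
`H_{𝓕^λ}` dying at `λ` lie in `H_𝓕`). RESULT `natCard_map_localization_signPart_relaxedAt`: the
conjunct `hPT` of `Koly.jetchevMaxHLAtThree_of_facts_of_selmerSupply` at one conductor, GIVEN the named
fact's family `inv` (Poitou–Tate package), a `τ`-equivariant Weil datum, `h𝒯σ`/`h𝒯sd` at the places of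
`c`, and `hloc`.
References (locators only; no cited FACT is declared): [cite: Jetchev2008, Lemma 5.2 (iii) (p. 822),
Thm. 5.1, proof of Prop. 5.3 (pp. 823–824)] [cite: Howard2004HeegnerKolyvagin, Thm. 2.1.11, Prop. 2.2.?]
[cite: MazurRubin2004, Lemma 4.1.7] [cite: MilneADT2006, Ch. I, Cor. 3.4, Thm. 4.10(b)]. Design: no
definitions; `K : Type`. Axioms: `propext`, `Classical.choice`, `Quot.sound`.
-/

set_option autoImplicit false

noncomputable section

open scoped Classical Pointwise
open Function NumberField IsDedekindDomain WeierstrassCurve Field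
open Literature.NumberTheory.EllipticCurves Literature.NumberTheory.GaloisRepresentations
open Literature.NumberTheory.EllipticCurves.Jetchev2008
open Literature.NumberTheory.GaloisCohomology Literature.NumberTheory.Automorphic
open Literature.NumberTheory.GaloisRepresentations.DiscreteGaloisModule (localTatePairingZMod
  tateDual SelmerStructure)
open Summit.BirchSwinnertonDyer.Rank1Residual.JET.SelmerVocabulary
open Summit.BirchSwinnertonDyer.Rank1Residual.JET.GlobalDuality
open Literature.NumberTheory.NumberFields.Honda1971 (natCast_notMem_of_coprime)

namespace Summit.BirchSwinnertonDyer.Rank1Residual.JET.Walk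

/-! ### Index bookkeeping: `#f(A) = [A : B] · #f(B)` when `A ∩ ker f ≤ B ≤ A` -/

section Index

variable {G X : Type*} [AddCommGroup G] [AddCommGroup X]

/-- For `B ≤ A ≤ G` with `A ∩ ker f ≤ B`: `#f(A) = [A : B] · #f(B)` (`[A : A ∩ ker f] =
[A : B]·[B : B ∩ ker f]`). [folklore] -/
theorem natCard_map_eq_relIndex_mul (f : G →+ X) {A B : AddSubgroup G} (hBA : B ≤ A)
    (hker : A ⊓ f.ker ≤ B) :
    Nat.card (A.map f) = B.relIndex A * Nat.card (B.map f) := by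
  rw [← AddSubgroup.relIndex_ker, ← AddSubgroup.relIndex_ker]
  have h0 : f.ker.relIndex A = (f.ker ⊓ A).relIndex A := (AddSubgroup.inf_relIndex_right _ _).symm
  have h1 : (f.ker ⊓ A).relIndex A = (f.ker ⊓ A).relIndex B * B.relIndex A :=
    (AddSubgroup.relIndex_mul_relIndex (f.ker ⊓ A) B A
      (by rw [inf_comm]; exact hker) hBA).symm
  have h2 : (f.ker ⊓ A).relIndex B = f.ker.relIndex B := by
    rw [AddSubgroup.relIndex, AddSubgroup.relIndex]
    congr 1
    ext x
    simp only [AddSubgroup.mem_addSubgroupOf, AddSubgroup.mem_inf, and_iff_left_iff_imp]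
    exact fun _ ↦ hBA x.2
  rw [h0, h1, h2, mul_comm]

end Index

/-! ### `hPT` at one conductor -/

section PT

variable {K : Type} [Field K] [NumberField K] (W : WeierstrassCurve ℚ) [W.IsElliptic]
  [W.IsGloballyMinimal]
  (τ : K ≃ₐ[ℚ] K) (p k : ℕ) [Fact p.Prime] [NeZero (p ^ k)]
  [Finite (geomTorsion (W.baseChange K) ((p ^ k : ℕ) : ℤ))]
  (e : geomTorsion (W.baseChange K) ((p ^ k : ℕ) : ℤ) → geomTorsion (W.baseChange K) ((p ^ k : ℕ) : ℤ) →
    AlgebraicClosure K)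
  (hμ : ∀ S T, e S T ^ (p ^ k) = 1)
  (hadd₁ : ∀ S₁ S₂ T, e (S₁ + S₂) T = e S₁ T * e S₂ T)
  (hadd₂ : ∀ S T₁ T₂, e S (T₁ + T₂) = e S T₁ * e S T₂)
  (hgal : ∀ (g : absoluteGaloisGroup K) (S T : geomTorsion (W.baseChange K) ((p ^ k : ℕ) : ℤ)),
    g • e S T = e (g • S) (g • T))
  (halt : ∀ T, e T T = 1) (hnondeg : ∀ T, (∀ S, e S T = 1) → T = 0)
  (hτe : ∀ S T, liftAut τ (e S T) =
    e ((isLiftOfAut_liftAut τ).torsionMap W ((p ^ k : ℕ) : ℤ) S)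
      ((isLiftOfAut_liftAut τ).torsionMap W ((p ^ k : ℕ) : ℤ) T))

include halt hnondeg hτe in
/-- **Jetchev Lemma 5.2 (iii), primal form: `#loc_λ((H_{𝓕(c)^λ})^s) = p^k`** at the prime `λ = v` of
`K` above a Kolyvagin prime `ℓ ∤ c` of index `≥ k`, either sign `s = ±1`, for
`𝓕(c) = selmerF W p^k 𝒯 (placesDividing K c)` with `𝒯` `τ`-stable and self-dual at the places of `c` —
GIVEN the Poitou–Tate package `inv` of the named fact, a `τ`-equivariant Weil datum and the local term
`[H¹(K_λ)^s : Kum_λ^s] = p^k` (Lemma 5.2 (i)–(ii)). Signed counting for `𝓕 ≤ 𝓕^λ`, self-duality of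
`𝓕(c)` under the Weil transport, and `#loc_λ(H_{𝓕^λ}^s) = [H_{𝓕^λ}^s : H_𝓕^s]·#loc_λ(H_𝓕^s)`.
[cite: Jetchev2008, Lemma 5.2 (iii) (p. 822), Thm. 5.1] [cite: MazurRubin2004, Lemma 4.1.7]
[cite: MilneADT2006, Ch. I, Cor. 3.4, Thm. 4.10(b)] -/
theorem natCard_map_localization_signPart_relaxedAt (hτ : τ * τ = 1) (hp2 : p ≠ 2) (hk : 1 ≤ k)
    (inv : LocalInvariants K (p ^ k)) (hperf : inv.IsPerfect) (hvan : inv.SumLocalTermEqZero)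
    (hSC : inv.SelmerComplement) (hinv : inv.IsConjCompatible τ)
    (𝒯 : SelmerStructure ((W.baseChange K).torsionGaloisModule ((p ^ k : ℕ) : ℤ)))
    {c : ℕ} (hc : c ≠ 0)
    (h𝒯σ : ∀ (v w : HeightOneSpectrum (𝓞 K)) (h : τ • v = w), v ∈ placesDividing K c →
      ∀ x : galoisCohomology (((W.baseChange K).torsionGaloisModule ((p ^ k : ℕ) : ℤ)).toLocal
        (Sum.inr v : Place K)) 1,
      x ∈ 𝒯 (Sum.inr v) → conjActPlace W τ ((p ^ k : ℕ) : ℤ) h x ∈ 𝒯 (Sum.inr w))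
    (h𝒯sd : ∀ v ∈ placesDividing K c,
      inv.dualTransported 𝒯 (weilDualIntertwining (W.baseChange K) (p ^ k) e hμ hadd₁ hadd₂ hgal)
        (Sum.inr v) = 𝒯 (Sum.inr v))
    {s : ℤ} (hs : s = 1 ∨ s = -1)
    (hloc : ∀ ℓ : ℕ, Zhang2014.IsKolyvaginPrime (W.conductorNorm ℤ) W K p ℓ →
      k ≤ Zhang2014.kolyvaginIndex W p ℓ → ℓ ∉ c.primeFactors →
      ∀ (v : HeightOneSpectrum (𝓞 K)), (ℓ : 𝓞 K) ∈ v.asIdeal → ∀ (hfix : τ • v = v),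
      ((W.baseChange K).kummerSelmerStructure ((p ^ k : ℕ) : ℤ) (Sum.inr v)).relIndex
        ((conjActPlace W τ ((p ^ k : ℕ) : ℤ) hfix - s • AddMonoidHom.id _).ker) = p ^ k) :
    ∀ ℓ : ℕ, Zhang2014.IsKolyvaginPrime (W.conductorNorm ℤ) W K p ℓ → k ≤ Zhang2014.kolyvaginIndex W p ℓ →
      ℓ ∉ c.primeFactors → ∀ (v : HeightOneSpectrum (𝓞 K)), (ℓ : 𝓞 K) ∈ v.asIdeal →
      Nat.card ((signPart W K τ ((p ^ k : ℕ) : ℤ) s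
          (((selmerF W ((p ^ k : ℕ) : ℤ) 𝒯 (placesDividing K c)).relaxedAt {v}).selmerGroup)).map
        (galoisCohomology.localization ((W.baseChange K).torsionGaloisModule ((p ^ k : ℕ) : ℤ))
          (Sum.inr v : Place K) 1)) = p ^ k := by
  intro ℓ hKol hkℓ hℓc v hv
  -- basic facts
  have hp : p.Prime := Fact.out
  have hodd : Odd (p ^ k) := (hp.odd_of_ne_two hp2).pow
  have hk0 : k ≠ 0 := by omega
  have hppow : IsPrimePow (p ^ k) := ⟨p, k, hp.prime, Nat.pos_of_ne_zero hk0, rfl⟩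
  have hM : ∀ P : geomTorsion (W.baseChange K) ((p ^ k : ℕ) : ℤ), (p ^ k) • P = 0 := fun P => by
    simpa using (W.baseChange K).natAbs_nsmul_geomTorsion P
  have hinj : ∀ v : HeightOneSpectrum (𝓞 K), Injective (inv (Sum.inr v)) := fun v => (hperf v).1.injective
  -- the prime `λ = v`: fixed, prime to `c`
  have hℓ : ℓ.Prime := hKol.1
  have hfix : τ • v = v := smul_place_eq_self_of_natCast_mem τ hℓ.ne_zero hKol.2.2.2.2.1 v hv
  have hvc : v ∉ placesDividing K c := by
    rw [mem_placesDividing_iff_natCast_mem hc]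
    refine natCast_notMem_of_coprime ((Nat.Prime.coprime_iff_not_dvd hℓ).mpr fun h => ?_) _ hv
    exact hℓc (Nat.mem_primeFactors.mpr ⟨hℓ, h, hc⟩)
  -- the structure `𝓕 = 𝓕(c)` and its properties
  set F := selmerF W ((p ^ k : ℕ) : ℤ) 𝒯 (placesDividing K c) with hF
  set Kum := (W.baseChange K).kummerSelmerStructure ((p ^ k : ℕ) : ℤ) with hKum
  set loc := galoisCohomology.localization ((W.baseChange K).torsionGaloisModule ((p ^ k : ℕ) : ℤ))
    (Sum.inr v : Place K) 1 with hlocdef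
  set wH := galoisCohomology.map (weilDualIntertwining (W.baseChange K) (p ^ k) e hμ hadd₁ hadd₂ hgal) 1
    with hwH
  have hFσ := conjActPlace_mem_selmerF W τ ((p ^ k : ℕ) : ℤ) 𝒯 hc h𝒯σ
  have hFinf : ∀ w : InfinitePlace K, F (Sum.inl w) = ⊤ := fun w =>
    addSubgroup_inl_eq_top_of_odd W (p ^ k) hodd w _
  have hFdinf : ∀ w : InfinitePlace K,
      inv.dualSelmerStructure ((W.baseChange K).torsionGaloisModule ((p ^ k : ℕ) : ℤ)) F (Sum.inl w) = ⊤ :=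
    fun w => addSubgroup_tateDual_inl_eq_top_of_odd W (p ^ k) hodd w _
  have hFv : F (Sum.inr v) = Kum (Sum.inr v) := by
    rw [hF, selmerF_inr, if_neg hvc]
  -- self-duality of `𝓕(c)` under the Weil transport
  have hsd : ∀ v', inv.dualTransported F
      (weilDualIntertwining (W.baseChange K) (p ^ k) e hμ hadd₁ hadd₂ hgal) v' = F v' :=
    dualTransported_selmerF_eq W (p ^ k) e hμ hadd₁ hadd₂ hgal halt hnondeg hppow hodd inv hinj 𝒯 c h𝒯sd
  -- an exceptional set containing `λ`
  obtain ⟨S, T, hPT, hST, hTσ, -, hSram, h𝓚⟩ :=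
    exists_symmetric_exceptional W τ p k hτ (placesDividing K c ∪ {v})
  have hcS : ∀ v ∈ placesDividing K c, (Sum.inr v : Place K) ∈ S := fun v hv =>
    (hST v).mpr (hPT (Finset.mem_union_left _ hv))
  have hvT : v ∈ T := hPT (Finset.mem_union_right _ (Finset.mem_singleton_self v))
  have hFunr := selmerF_isUnramifiedOutside W ((p ^ k : ℕ) : ℤ) 𝒯 (c := c) h𝓚 hcS
  -- the signed counting for `𝓕 ≤ 𝓕^λ`
  have key := relIndex_mul_natCard_map_eq_of_relaxedAt W τ ((p ^ k : ℕ) : ℤ) hτ hodd hM inv hperf hvan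
    hSC hinv S T hST hTσ hSram hFunr hFσ hFinf hFdinf hvT hfix hs
  rw [show selmerF W ((p ^ k : ℕ) : ℤ) 𝒯 (placesDividing K c) (Sum.inr v) = Kum (Sum.inr v) from hFv,
    hloc ℓ hKol hkℓ hℓc v hv hfix] at key
  -- the dual factor is `#loc_λ(H_𝓕^s)` by self-duality and the Weil transport
  have hdual : Nat.card ((((inv.dualSelmerStructure _ F).selmerGroup ⊓
        (conjActDual W τ ((p ^ k : ℕ) : ℤ) (p ^ k) - s • AddMonoidHom.id _).ker)).map
        (galoisCohomology.localization (((W.baseChange K).torsionGaloisModule ((p ^ k : ℕ) : ℤ)).tateDual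
          (p ^ k)) (Sum.inr v : Place K) 1)) =
      Nat.card ((signPart W K τ ((p ^ k : ℕ) : ℤ) s F.selmerGroup).map loc) := by
    rw [← comap_map_weilDual_selmerGroup_of_selfDual W (p ^ k) e hμ hadd₁ hadd₂ hgal inv F hsd,
      signPart_comap_map_weilDual W τ p k e hμ hadd₁ hadd₂ hgal hnondeg hτe inv F s,
      ← natCard_map_localization_map_weilDual W (p ^ k) e hμ hadd₁ hadd₂ hgal hnondeg (Sum.inr v),
      map_comap_map_weilDual W (p ^ k) e hμ hadd₁ hadd₂ hgal hnondeg]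
  rw [hdual] at key
  -- `#loc_λ(H_{𝓕^λ}^s) = [H_{𝓕^λ}^s : H_𝓕^s] · #loc_λ(H_𝓕^s)`
  have hBA : signPart W K τ ((p ^ k : ℕ) : ℤ) s F.selmerGroup ≤
      signPart W K τ ((p ^ k : ℕ) : ℤ) s (F.relaxedAt {v}).selmerGroup :=
    signPart_mono W K τ _ s (GlobalDuality.selmerGroup_mono (le_relaxedAt W _ F {v}))
  have hkerB : signPart W K τ ((p ^ k : ℕ) : ℤ) s (F.relaxedAt {v}).selmerGroup ⊓ loc.ker ≤
      signPart W K τ ((p ^ k : ℕ) : ℤ) s F.selmerGroup := by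
    intro x hx
    obtain ⟨hx, hx0⟩ := hx
    obtain ⟨hxF, hxs⟩ := (mem_signPart_iff W K τ _ s _ _).mp hx
    refine (mem_signPart_iff W K τ _ s _ _).mpr ⟨?_, hxs⟩
    rw [mem_selmerGroup_iff_of_mem_relaxedAt W _ F v hxF, (AddMonoidHom.mem_ker).mp hx0]
    exact zero_mem _
  rw [natCard_map_eq_relIndex_mul loc hBA hkerB]
  exact key

end PT

end Summit.BirchSwinnertonDyer.Rank1Residual.JET.Walk

end
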